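import Mathlib
import Summits.Ventures.PercRepro2.MixChordOPendantBlockConn
import Summits.Ventures.PercRepro2.MixChordOChords

/-!
# Connectivity readings of the `o`–ROOT STAR (blind cell PercRepro2, night-1 g24; proofs/NIGHT1-G24.md §2)

`a₃` has exactly two edges, `g = {a₃, o}` and `e = {a₃, a₁}` (`hstar`).  For a configuration `ω₀` with both
closed, `a₃` is isolated (`not_conn_a3_of_closed`); with `g` opened it is a leaf at `o` and the connections
among the other vertices are unchanged (`conn_update_g_iff`, `conn_a3_update_g_iff`); with `e` opened a leaf
at `a₁` (`conn_update_e_iff`, `conn_a3_update_e_iff`); with BOTH opened the other vertices are connected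
exactly as in `ω₀` with the `o`-edge `f = {o, a₁}` opened (`conn_update_ge_iff`) and `a₃` reads as `a₁`
(`conn_a3_update_ge_iff`).  Tools: g23's one-extra-edge lemma `Block.conn_iff_of_open_edge` and the
closure lemma `mem_of_conn_of_closed`; the edge between two already connected vertices is redundant
(`conn_update_iff_of_conn`).  Own code; standard axioms.
-/

namespace Summit.Ventures.PercRepro2

open UnionCluster CovForm

namespace Mix

namespace OStar

section Conn

variable {V : Type*} {E : Type*} [DecidableEq E] {ends : E → Sym2 V}

/-- An edge whose endpoints are already connected without it does not change any connection. -/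
lemma conn_update_iff_of_conn {f : E} {u v : V} (hf : ends f = s(u, v)) {ω : Config E}
    (h : Conn ends (Function.update ω f false) u v) (c : Bool) (x y : V) :
    Conn ends (Function.update ω f c) x y ↔ Conn ends (Function.update ω f false) x y := by
  cases c
  · exact Iff.rfl
  · have key := Block.conn_iff_of_open_edge hf (ω := Function.update ω f true) (by simp) x y
    rw [Function.update_idem] at key
    rw [key]
    constructor
    · rintro (h1 | ⟨h1, h2⟩ | ⟨h1, h2⟩)
      · exact h1
      · exact conn_trans h1 (conn_trans h h2)
      · exact conn_trans h1 (conn_trans (conn_symm h) h2)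
    · intro h1
      exact Or.inl h1

/-- The same, for a configuration in which the edge is already open. -/
lemma conn_iff_update_false_of_conn {f : E} {u v : V} (hf : ends f = s(u, v)) {ω : Config E}
    (h : Conn ends (Function.update ω f false) u v) (x y : V) :
    Conn ends ω x y ↔ Conn ends (Function.update ω f false) x y := by
  have := conn_update_iff_of_conn hf h (ω f) x y
  rwa [Function.update_eq_self] at this

variable {g e : E} {o a₁ a₃ : V}

omit [DecidableEq E] in
/-- With both edges of `a₃` closed, `a₃` is isolated. -/
lemma not_conn_a3_of_closed (hstar : ∀ e', a₃ ∈ ends e' → e' = g ∨ e' = e) {ω : Config E} (hωg : ω g = false) (hωe : ω e = false) {x : V}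
    (hx : x ≠ a₃) : ¬ Conn ends ω x a₃ := by
  intro h
  have hmem : a₃ ∈ ({y : V | y ≠ a₃} : Set V) :=
    mem_of_conn_of_closed (S := {y : V | y ≠ a₃}) (fun y hy z hadj => by
      rw [openGraph_adj] at hadj
      obtain ⟨_, e', he', hends⟩ := hadj
      intro hz
      rw [hz] at hends
      have h3 : a₃ ∈ ends e' := by rw [hends]; exact Sym2.mem_mk_right y a₃
      rcases hstar e' h3 with h' | h'
      · rw [h', hωg] at he'; exact Bool.false_ne_true he'
      · rw [h', hωe] at he'; exact Bool.false_ne_true he') hx h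
  exact hmem rfl

/-- Opening `g` (with `e` closed) does not change the connections among vertices other than `a₃`. -/
lemma conn_update_g_iff (hg : ends g = s(a₃, o)) (hstar : ∀ e', a₃ ∈ ends e' → e' = g ∨ e' = e) {ω : Config E} (hωg : ω g = false) (hωe : ω e = false) {x y : V}
    (hx : x ≠ a₃) (hy : y ≠ a₃) :
    Conn ends (Function.update ω g true) x y ↔ Conn ends ω x y := by
  have key := Block.conn_iff_of_open_edge hg (ω := Function.update ω g true) (by simp) x y
  have hself : Function.update ω g false = ω := Function.update_eq_self_iff.2 hωg.symm
  rw [Function.update_idem, hself] at key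
  rw [key]
  have h1 := not_conn_a3_of_closed hstar hωg hωe hx
  have h2 := not_conn_a3_of_closed hstar hωg hωe hy
  constructor
  · rintro (h | ⟨h, _⟩ | ⟨_, h⟩)
    · exact h
    · exact absurd h h1
    · exact absurd (conn_symm h) h2
  · exact fun h => Or.inl h

/-- With `g` open (and `e` closed) `a₃` is joined to exactly what `o` is joined to. -/
lemma conn_a3_update_g_iff (hg : ends g = s(a₃, o)) (hstar : ∀ e', a₃ ∈ ends e' → e' = g ∨ e' = e) {ω : Config E} (hωg : ω g = false) (hωe : ω e = false) {x : V}
    (hx : x ≠ a₃) :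
    Conn ends (Function.update ω g true) x a₃ ↔ Conn ends ω x o := by
  have key := Block.conn_iff_of_open_edge hg (ω := Function.update ω g true) (by simp) x a₃
  have hself : Function.update ω g false = ω := Function.update_eq_self_iff.2 hωg.symm
  rw [Function.update_idem, hself] at key
  rw [key]
  have h1 := not_conn_a3_of_closed hstar hωg hωe hx
  constructor
  · rintro (h | ⟨h, _⟩ | ⟨h, _⟩)
    · exact absurd h h1
    · exact absurd h h1
    · exact h
  · exact fun h => Or.inr (Or.inr ⟨h, conn_refl ends ω a₃⟩)

/-- Opening `e` (with `g` closed) does not change the connections among vertices other than `a₃`. -/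
lemma conn_update_e_iff (he : ends e = s(a₃, a₁)) (hstar : ∀ e', a₃ ∈ ends e' → e' = g ∨ e' = e) {ω : Config E} (hωg : ω g = false) (hωe : ω e = false) {x y : V}
    (hx : x ≠ a₃) (hy : y ≠ a₃) :
    Conn ends (Function.update ω e true) x y ↔ Conn ends ω x y := by
  have key := Block.conn_iff_of_open_edge he (ω := Function.update ω e true) (by simp) x y
  have hself : Function.update ω e false = ω := Function.update_eq_self_iff.2 hωe.symm
  rw [Function.update_idem, hself] at key
  rw [key]
  have h1 := not_conn_a3_of_closed hstar hωg hωe hx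
  have h2 := not_conn_a3_of_closed hstar hωg hωe hy
  constructor
  · rintro (h | ⟨h, _⟩ | ⟨_, h⟩)
    · exact h
    · exact absurd h h1
    · exact absurd (conn_symm h) h2
  · exact fun h => Or.inl h

/-- With `e` open (and `g` closed) `a₃` is joined to exactly what `a₁` is joined to. -/
lemma conn_a3_update_e_iff (he : ends e = s(a₃, a₁)) (hstar : ∀ e', a₃ ∈ ends e' → e' = g ∨ e' = e) {ω : Config E} (hωg : ω g = false) (hωe : ω e = false) {x : V}
    (hx : x ≠ a₃) :
    Conn ends (Function.update ω e true) x a₃ ↔ Conn ends ω x a₁ := by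
  have key := Block.conn_iff_of_open_edge he (ω := Function.update ω e true) (by simp) x a₃
  have hself : Function.update ω e false = ω := Function.update_eq_self_iff.2 hωe.symm
  rw [Function.update_idem, hself] at key
  rw [key]
  have h1 := not_conn_a3_of_closed hstar hωg hωe hx
  constructor
  · rintro (h | ⟨h, _⟩ | ⟨h, _⟩)
    · exact absurd h h1
    · exact absurd h h1
    · exact h
  · exact fun h => Or.inr (Or.inr ⟨h, conn_refl ends ω a₃⟩)

variable {f : E}

/-- The `e`-closed configuration `ω[f ↦ 1][g ↦ 1]` has `a₃ ↔ a₁` (through `g` and `f`). -/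
lemma conn_a3_a1_fg (hg : ends g = s(a₃, o)) (hf : ends f = s(o, a₁)) (hgf : g ≠ f) {ω : Config E} :
    Conn ends (Function.update (Function.update ω f true) g true) a₃ a₁ := by
  have h1 : Conn ends (Function.update (Function.update ω f true) g true) a₃ o :=
    conn_of_openAdj ⟨g, by simp, hg⟩
  have h2 : Conn ends (Function.update (Function.update ω f true) g true) o a₁ :=
    conn_of_openAdj ⟨f, by rw [Function.update_of_ne hgf.symm]; simp, hf⟩
  exact conn_trans h1 h2

/-- `ω[g ↦ 1][e ↦ 1][f ↦ 1]` rewritten with `f` first. -/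
lemma update_gef_eq (hgf : g ≠ f) (hef : e ≠ f) {ω : Config E} :
    Function.update (Function.update (Function.update ω g true) e true) f true =
      Function.update (Function.update (Function.update ω f true) g true) e true := by
  rw [Function.update_comm hef, Function.update_comm hgf]

/-- With `g`, `e` open the edge `f` is redundant: a connection is read in `ω[g ↦ 1][e ↦ 1][f ↦ 1]`. -/
lemma conn_update_ge_iff_f (hg : ends g = s(a₃, o)) (he : ends e = s(a₃, a₁)) (hf : ends f = s(o, a₁))
    (hge : g ≠ e) (hgf : g ≠ f) (hef : e ≠ f) {ω : Config E} (x y : V) :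
    Conn ends (Function.update (Function.update ω g true) e true) x y ↔
      Conn ends (Function.update (Function.update (Function.update ω g true) e true) f true) x y := by
  have hoa : Conn ends (Function.update (Function.update (Function.update ω g true) e true) f false) o a₁ := by
    have hgo : Conn ends (Function.update (Function.update (Function.update ω g true) e true) f false) a₃ o :=
      conn_of_openAdj ⟨g, by rw [Function.update_of_ne hgf, Function.update_of_ne hge]; simp, hg⟩
    have hea : Conn ends (Function.update (Function.update (Function.update ω g true) e true) f false) a₃ a₁ :=
      conn_of_openAdj ⟨e, by rw [Function.update_of_ne hef]; simp, he⟩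
    exact conn_trans (conn_symm hgo) hea
  rw [conn_iff_update_false_of_conn hf hoa x y, conn_update_iff_of_conn hf hoa true x y]

/-- **Both edges open**: the vertices other than `a₃` are connected as in `ω` with the `o`-edge `f`
opened. -/
lemma conn_update_ge_iff (hg : ends g = s(a₃, o)) (he : ends e = s(a₃, a₁))
    (hstar : ∀ e', a₃ ∈ ends e' → e' = g ∨ e' = e) (hf : ends f = s(o, a₁))
    (hge : g ≠ e) (hgf : g ≠ f) (hef : e ≠ f) {ω : Config E} (hωg : ω g = false) (hωe : ω e = false) {x y : V}
    (hx : x ≠ a₃) (hy : y ≠ a₃) :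
    Conn ends (Function.update (Function.update ω g true) e true) x y ↔
      Conn ends (Function.update ω f true) x y := by
  rw [conn_update_ge_iff_f hg he hf hge hgf hef x y, update_gef_eq hgf hef]
  -- `e` is redundant in `ω[f ↦ 1][g ↦ 1]`
  have hcl : Function.update (Function.update (Function.update ω f true) g true) e false =
      Function.update (Function.update ω f true) g true := by
    rw [Function.update_eq_self_iff, Function.update_of_ne hge.symm, Function.update_of_ne hef, hωe]
  have h3 : Conn ends (Function.update (Function.update (Function.update ω f true) g true) e false) a₃ a₁ := by
    rw [hcl]; exact conn_a3_a1_fg hg hf hgf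
  rw [conn_update_iff_of_conn he h3 true x y, hcl]
  -- `a₃` is a leaf at `o` in `ω[f ↦ 1][g ↦ 1]`
  have hg' : Function.update ω f true g = false := by rw [Function.update_of_ne hgf, hωg]
  have he' : Function.update ω f true e = false := by rw [Function.update_of_ne hef, hωe]
  exact conn_update_g_iff hg hstar hg' he' hx hy

/-- **Both edges open**: `a₃` is joined to exactly what `a₁` is joined to in `ω` with `f` opened. -/
lemma conn_a3_update_ge_iff (hg : ends g = s(a₃, o)) (he : ends e = s(a₃, a₁))
    (hstar : ∀ e', a₃ ∈ ends e' → e' = g ∨ e' = e) (hf : ends f = s(o, a₁))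
    (hge : g ≠ e) (hgf : g ≠ f) (hef : e ≠ f) (h31 : a₃ ≠ a₁) {ω : Config E} (hωg : ω g = false) (hωe : ω e = false)
    {x : V} (hx : x ≠ a₃) :
    Conn ends (Function.update (Function.update ω g true) e true) x a₃ ↔
      Conn ends (Function.update ω f true) x a₁ := by
  rw [conn_update_ge_iff_f hg he hf hge hgf hef x a₃, update_gef_eq hgf hef]
  have hcl : Function.update (Function.update (Function.update ω f true) g true) e false =
      Function.update (Function.update ω f true) g true := by
    rw [Function.update_eq_self_iff, Function.update_of_ne hge.symm, Function.update_of_ne hef, hωe]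
  have h3 : Conn ends (Function.update (Function.update (Function.update ω f true) g true) e false) a₃ a₁ := by
    rw [hcl]; exact conn_a3_a1_fg hg hf hgf
  have hea : Conn ends (Function.update (Function.update (Function.update ω f true) g true) e true) a₃ a₁ :=
    conn_of_openAdj ⟨e, by simp, he⟩
  have step : Conn ends (Function.update (Function.update (Function.update ω f true) g true) e true) x a₃ ↔
      Conn ends (Function.update (Function.update (Function.update ω f true) g true) e true) x a₁ :=
    ⟨fun h => conn_trans h hea, fun h => conn_trans h (conn_symm hea)⟩
  rw [step, conn_update_iff_of_conn he h3 true x a₁, hcl]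
  have hg' : Function.update ω f true g = false := by rw [Function.update_of_ne hgf, hωg]
  have he' : Function.update ω f true e = false := by rw [Function.update_of_ne hef, hωe]
  exact conn_update_g_iff hg hstar hg' he' hx h31.symm

end Conn

end OStar

end Mix

end Summit.Ventures.PercRepro2
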